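import Literature.AlgebraicGeometry.Resolution.CharPolyhedronSolvableVertex
import HarnessLib

/-!
# The characteristic polyhedron at the origin of a blow-up chart (Cossart–Piltant 2019, Prop. 2.6)

Topic: `Literature/AlgebraicGeometry/Resolution`. PROOF-side file continuing
`MonomialIdealsRegularParameters.lean` (Prop. 2.1, `𝐒(f)`, transport of expansions) and
`CharPolyhedronSolvableVertex.lean` (`minExponents`), in support of the named fact
`CossartPiltant2019Local` (`ArithmeticalThreefoldsLocal.lean`). Source:

* V. Cossart, O. Piltant, *Resolution of singularities of arithmetical threefolds*, J. Algebra
  529 (2019) 268–535 = arXiv:1412.0868 (v1), Prop. 2.6 (v1 pp. 13–14): for `J ∋ j₀`,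
  `S' := S[u_j/u_{j₀} : j ∈ J]_{(u'_1, …, u'_n)}` with `u'_j := u_j/u_{j₀}` (`j ∈ J ∖ {j₀}`),
  `u'_j := u_j` otherwise, and `h'(Z') := u_{j₀}^{-m} h(u_{j₀} Z')`, one has
  `l(Δ_S(h; u; Z)) = Δ_{S'}(h'; u'; Z')` for `l(x) = (x_1, …, Σ_{j ∈ J} x_j - 1, …, x_n)` (the
  `j₀`-th coordinate replaced), because "`(1/i) 𝐒(f_{i,Z'}) ⊆ l((1/i) 𝐒(f_{i,Z}))`".

We work with ABSTRACT chart data — a ring homomorphism `ψ : S → S'` and families `u`, `u'` with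
`ψ(u_j) = u'_{j₀} u'_j` for `j ∈ J ∖ {j₀}` and `ψ(u_j) = u'_j` otherwise (the origin of the
`j₀`-chart of the blow-up along `I_J`; the tree's `chartRing`/`isRsopPart_chartFamily_reesChart`
of `BlowupChartRsop.lean` provide the instance) — and PROVE:

* `map_uPow_eq_uPow_update` — `ψ(u^a) = u'^{l₀(a)}` with `l₀(a) = a` except
  `l₀(a)_{j₀} = Σ_{j ∈ J} a_j` (`Function.update a j₀ (Σ_{j ∈ J} a_j)`); `update_sum_injective`;
* `exists_minimal_map_origin` — **`𝐒(ψ f)` is the set of minimal elements of `l₀(𝐒(f))`**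
  (Prop. 2.6, proof: "Since `l` is one-to-one, `(1/i) 𝐒(f_{i,Z'}) ⊆ l((1/i) 𝐒(f_{i,Z}))`"), for
  `ψ` reflecting `(u')` into `(u)` and `u'` satisfying (H);
* `exists_minimal_of_mul_pow_eq` — dividing by `u'_{j₀}^i`: if `g · u'_{j₀}^i = ψ(f)` and every
  `a ∈ 𝐒(f)` has `Σ_{j ∈ J} a_j ≥ i` (i.e. `f ∈ I_J^i`, the hypothesis `δ(y) ≥ 1` of Prop. 2.6),
  then `𝐒(g)` is the set of minimal elements of `l₀(𝐒(f)) - i e_{j₀}` — the coefficients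
  `f_{i,Z'} = u_{j₀}^{-i} f_{i,Z}` of `h'`, so that `(1/i) 𝐒(f_{i,Z'}) ⊆ l((1/i) 𝐒(f_{i,Z}))`;
* `minExponents_of_mul_pow_eq`, `coeffClass_of_mul_pow_eq` — the same for the tree's `𝐒(·)` and
  `γ̄(·, ·)` (`CharPolyhedronSolvableVertex.lean`): `γ̄'(f_{i,Z'}, l₀(a) - ie_{j₀}) = ψ̄(γ̄(f_{i,Z}, a))`;
* `isVertexFor_of_isVertexFor_map` — **vertices of `Δ_{S'}(h'; u'; Z')` come from vertices of
  `Δ_S(h; u; Z)`**: if `l(x)` is cut out by `α' > 0` then `x` is cut out by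
  `β = (α'_j + α'_{j₀} [j ∈ J ∖ j₀]; α'_j)` (`⟨α', l(y)⟩ = ⟨β, y⟩ - α'_{j₀}`,
  `sum_mul_update_sum_sub_one`);
* `exists_isSolvableVertex_of_isSolvableVertex_map`, `isMinimal_map_of_isMinimal` — **Prop. 2.6,
  second statement**: a solvable vertex of `Δ'` comes from a solvable vertex of `Δ` ("since
  `S'/m_{S'} = S/m_S`"), so `Δ_S(h; u; Z)` minimal implies `Δ_{S'}(h'; u'; Z')` minimal.

Here `h'` is any monic polynomial over `S'` of degree `m` with `f_{i,Z'} · u'_{j₀}^i = ψ(f_{i,Z})`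
(the polynomial `u_{j₀}^{-m} h(u_{j₀} Z')` of (2.7)), and `S/(u) → S'/(u')` is assumed bijective
(`hψ`, `hsurj`). Everything is PROVED; no definitions and no named facts are introduced.
-/

open Finset IsLocalRing

namespace Literature.AlgebraicGeometry.Resolution.CossartPiltant

universe u

variable {S : Type u} [CommRing S] {S' : Type*} [CommRing S'] {n : ℕ}

/-! ## The monomial substitution of the origin chart -/

/-- **`ψ(u^a) = u'^{l₀(a)}`** for the origin chart: `ψ(u_j) = u'_{j₀} u'_j` (`j ∈ J ∖ {j₀}`),
`ψ(u_j) = u'_j` otherwise, and `l₀(a) = a` except `l₀(a)_{j₀} = Σ_{j ∈ J} a_j`.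
[cite: CossartPiltant2019, Prop. 2.6 (arXiv v1 p. 13)] -/
theorem map_uPow_eq_uPow_update (ψ : S →+* S') (u : Fin n → S) (u' : Fin n → S')
    {J : Finset (Fin n)} {j₀ : Fin n} (hj₀ : j₀ ∈ J)
    (hrel : ∀ j, ψ (u j) = if j ∈ J ∧ j ≠ j₀ then u' j₀ * u' j else u' j) (a : Fin n → ℕ) :
    ψ (uPow u a) = uPow u' (Function.update a j₀ (∑ j ∈ J, a j)) := by
  classical
  unfold uPow
  rw [map_prod]
  simp_rw [map_pow, hrel]
  -- split off the factor `u'_{j₀}` from the `j ∈ J ∖ {j₀}` terms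
  have hsplit : ∀ j, (if j ∈ J ∧ j ≠ j₀ then u' j₀ * u' j else u' j) ^ a j =
      (if j ∈ J ∧ j ≠ j₀ then u' j₀ ^ a j else 1) * u' j ^ a j := by
    intro j
    split_ifs with h
    · rw [mul_pow]
    · rw [one_mul]
  simp_rw [hsplit]
  rw [Finset.prod_mul_distrib, Finset.prod_ite, Finset.prod_const_one, mul_one,
    Finset.prod_pow_eq_pow_sum]
  -- both sides: split off the `j₀` factor
  rw [← Finset.mul_prod_erase Finset.univ (fun j => u' j ^ a j) (Finset.mem_univ j₀),
    ← Finset.mul_prod_erase Finset.univ (fun j => u' j ^ Function.update a j₀ (∑ j ∈ J, a j) j)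
      (Finset.mem_univ j₀)]
  have hrest : ∏ j ∈ Finset.univ.erase j₀, u' j ^ Function.update a j₀ (∑ j ∈ J, a j) j =
      ∏ j ∈ Finset.univ.erase j₀, u' j ^ a j := by
    refine Finset.prod_congr rfl fun j hj => ?_
    rw [Function.update_of_ne (Finset.ne_of_mem_erase hj)]
  have hfilter : (Finset.univ.filter fun j => j ∈ J ∧ j ≠ j₀) = J.erase j₀ := by
    ext j
    simp [Finset.mem_erase, and_comm]
  rw [hrest, hfilter, Function.update_self, ← mul_assoc, ← pow_add, Finset.sum_erase_add _ _ hj₀]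

/-- `l₀` is injective. [folklore] -/
theorem update_sum_injective {J : Finset (Fin n)} {j₀ : Fin n} (hj₀ : j₀ ∈ J) :
    Function.Injective (fun a : Fin n → ℕ => Function.update a j₀ (∑ j ∈ J, a j)) := by
  classical
  intro a b hab
  have hne : ∀ j, j ≠ j₀ → a j = b j := by
    intro j hj
    have h1 : Function.update a j₀ (∑ j ∈ J, a j) j = Function.update b j₀ (∑ j ∈ J, b j) j :=
      congrFun hab j
    rwa [Function.update_of_ne hj, Function.update_of_ne hj] at h1
  have hsum : ∑ j ∈ J, a j = ∑ j ∈ J, b j := by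
    have h1 : Function.update a j₀ (∑ j ∈ J, a j) j₀ = Function.update b j₀ (∑ j ∈ J, b j) j₀ :=
      congrFun hab j₀
    rwa [Function.update_self, Function.update_self] at h1
  funext j
  by_cases hj : j = j₀
  · subst hj
    rw [← Finset.add_sum_erase _ _ hj₀, ← Finset.add_sum_erase _ _ hj₀] at hsum
    have : ∑ x ∈ J.erase j, a x = ∑ x ∈ J.erase j, b x :=
      Finset.sum_congr rfl fun x hx => hne x (Finset.ne_of_mem_erase hx)
    omega
  · exact hne j hj

/-! ## `𝐒(ψ f)` and `𝐒(u_{j₀}^{-i} f)` at the origin chart -/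

/-- **Prop. 2.6, proof: `𝐒(ψ f)` is the set of minimal elements of `l₀(𝐒(f))`** at the origin
chart (`ψ` reflecting `(u')` into `(u)`, e.g. a local homomorphism with `(u) = m_S`,
`(u') = m_{S'}`; `u'` satisfying (H)). [cite: CossartPiltant2019, Prop. 2.6, proof (arXiv v1 p. 13)] -/
theorem exists_minimal_map_origin (ψ : S →+* S') (u : Fin n → S) (u' : Fin n → S')
    (H' : ∀ (i : Fin n) (T : Finset (Fin n)), i ∉ T →
      ∀ y, u' i * y ∈ Ideal.span (u' '' ↑T) → y ∈ Ideal.span (u' '' ↑T))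
    {J : Finset (Fin n)} {j₀ : Fin n} (hj₀ : j₀ ∈ J)
    (hrel : ∀ j, ψ (u j) = if j ∈ J ∧ j ≠ j₀ then u' j₀ * u' j else u' j)
    (hψ : ∀ γ : S, ψ γ ∈ Ideal.span (Set.range u') → γ ∈ Ideal.span (Set.range u))
    {f : S} {A : Finset (Fin n → ℕ)} {γ : (Fin n → ℕ) → S}
    (hγ : ∀ a ∈ A, γ a ∉ Ideal.span (Set.range u)) (hf : f = ∑ a ∈ A, γ a * uPow u a) :
    ∃ M : Finset (Fin n → ℕ), IsAntichain (· ≤ ·) (↑M : Set (Fin n → ℕ)) ∧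
      M ⊆ A.image (fun a => Function.update a j₀ (∑ j ∈ J, a j)) ∧
      (∀ c ∈ A.image (fun a => Function.update a j₀ (∑ j ∈ J, a j)), ∃ m ∈ M, m ≤ c) ∧
      ψ f ∈ Ideal.span (uPow u' '' ↑M) ∧
      ∀ B : Set (Fin n → ℕ), ψ f ∈ Ideal.span (uPow u' '' B) → ∀ m ∈ M, ∃ b ∈ B, b ≤ m :=
  exists_minimal_map_of_expansion ψ u u' H' _ (update_sum_injective hj₀)
    (map_uPow_eq_uPow_update ψ u u' hj₀ hrel) hψ hγ hf

/-- **Dividing by `u'_{j₀}^i`** (the coefficients `f_{i,Z'} = u_{j₀}^{-i} f_{i,Z}` of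
`h' = u_{j₀}^{-m} h(u_{j₀} Z')`): if `g · u'_{j₀}^i = Σ_{m ∈ M} γ'_m u'^m` is an expansion over an
antichain `M` with coefficients `∉ (u')` and all `m_{j₀} ≥ i`, and `u'_{j₀}` is a
non-zero-divisor, then `g = Σ_{m ∈ M} γ'_m u'^{m - i e_{j₀}}` is such an expansion of `g`; hence
`𝐒(g) = 𝐒(g u'_{j₀}^i) - i e_{j₀}`. [cite: CossartPiltant2019, Prop. 2.6, proof (arXiv v1 p. 13)] -/
theorem expansion_of_mul_pow_eq (u' : Fin n → S') (j₀ : Fin n) (i : ℕ)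
    (hnzd : ∀ y : S', u' j₀ * y = 0 → y = 0)
    {g : S'} {M : Finset (Fin n → ℕ)} {γ' : (Fin n → ℕ) → S'}
    (hM : ∀ m ∈ M, i ≤ m j₀) (hg : g * u' j₀ ^ i = ∑ m ∈ M, γ' m * uPow u' m) :
    g = ∑ m ∈ M, γ' m * uPow u' (m - i • Pi.single j₀ 1) := by
  -- `u'_{j₀}^i (g - Σ γ'_m u'^{m - i e}) = 0`
  have hpow : ∀ (k : ℕ) (y : S'), u' j₀ ^ k * y = 0 → y = 0 := by
    intro k
    induction k with
    | zero =>
      intro y hy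
      simpa using hy
    | succ k ih =>
      intro y hy
      rw [pow_succ, mul_assoc] at hy
      exact hnzd _ (ih _ hy)
  have hfactor : ∀ m ∈ M, uPow u' m = u' j₀ ^ i * uPow u' (m - i • Pi.single j₀ 1) := by
    intro m hm
    rw [← uPow_single u' j₀, ← uPow_nsmul, ← uPow_add]
    congr 1
    funext l
    by_cases hl : l = j₀
    · subst hl
      simp only [Pi.add_apply, Pi.smul_apply, Pi.sub_apply, Pi.single_eq_same, smul_eq_mul, mul_one]
      have := hM m hm
      omega
    · simp [hl]
  apply sub_eq_zero.mp
  apply hpow i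
  rw [mul_sub, Finset.mul_sum, mul_comm, hg, sub_eq_zero]
  refine Finset.sum_congr rfl fun m hm => ?_
  rw [hfactor m hm]
  ring

/-- Shifting an antichain by `-i e_{j₀}` (when all `m_{j₀} ≥ i`) gives an antichain. [folklore] -/
theorem isAntichain_image_sub_of_le {M : Finset (Fin n → ℕ)}
    (hM' : IsAntichain (· ≤ ·) (↑M : Set (Fin n → ℕ))) {j₀ : Fin n} {i : ℕ}
    (hM : ∀ m ∈ M, i ≤ m j₀) :
    IsAntichain (· ≤ ·)
      (↑(M.image (fun m => m - i • (Pi.single j₀ 1 : Fin n → ℕ))) : Set (Fin n → ℕ)) := by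
  classical
  intro a ha b hb hne hle
  obtain ⟨m₁, hm₁, rfl⟩ := Finset.mem_image.mp (Finset.mem_coe.mp ha)
  obtain ⟨m₂, hm₂, rfl⟩ := Finset.mem_image.mp (Finset.mem_coe.mp hb)
  have hne' : m₁ ≠ m₂ := fun h => hne (h ▸ rfl)
  refine hM' (Finset.mem_coe.mpr hm₁) (Finset.mem_coe.mpr hm₂) hne' fun l => ?_
  have h1 := hle l
  have h2 := hM m₁ hm₁
  have h3 := hM m₂ hm₂
  simp only [Pi.sub_apply, Pi.smul_apply, smul_eq_mul] at h1
  by_cases hl : l = j₀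
  · subst hl
    simp only [Pi.single_eq_same, mul_one] at h1
    exact (Nat.sub_le_sub_iff_right h3).mp h1
  · simp only [Pi.single_apply, if_neg hl, mul_zero, Nat.sub_zero] at h1
    exact h1

/-- **`𝐒(u_{j₀}^{-i} f)` at the origin chart** (Prop. 2.6, proof): for `g · u'_{j₀}^i = ψ(f)`
with `f = Σ_{a ∈ 𝐒(f)} γ_a u^a`, all `Σ_{j ∈ J} a_j ≥ i` (`f ∈ I_J^i`), `𝐒(g)` is the antichain of
minimal elements of `l₀(𝐒(f))` shifted by `-i e_{j₀}`, i.e. `(1/i) 𝐒(g) ⊆ l((1/i) 𝐒(f))` with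
`l(x) = (…, Σ_{j ∈ J} x_j - 1, …)`. [cite: CossartPiltant2019, Prop. 2.6, proof (arXiv v1 p. 13)] -/
theorem exists_minimal_of_mul_pow_eq (ψ : S →+* S') (u : Fin n → S) (u' : Fin n → S')
    (H' : ∀ (i : Fin n) (T : Finset (Fin n)), i ∉ T →
      ∀ y, u' i * y ∈ Ideal.span (u' '' ↑T) → y ∈ Ideal.span (u' '' ↑T))
    {J : Finset (Fin n)} {j₀ : Fin n} (hj₀ : j₀ ∈ J) (hnzd : ∀ y : S', u' j₀ * y = 0 → y = 0)
    (hrel : ∀ j, ψ (u j) = if j ∈ J ∧ j ≠ j₀ then u' j₀ * u' j else u' j)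
    (hψ : ∀ γ : S, ψ γ ∈ Ideal.span (Set.range u') → γ ∈ Ideal.span (Set.range u))
    {f : S} {A : Finset (Fin n → ℕ)} {γ : (Fin n → ℕ) → S}
    (hγ : ∀ a ∈ A, γ a ∉ Ideal.span (Set.range u)) (hf : f = ∑ a ∈ A, γ a * uPow u a)
    {i : ℕ} (hAi : ∀ a ∈ A, i ≤ ∑ j ∈ J, a j) {g : S'} (hg : g * u' j₀ ^ i = ψ f) :
    ∃ M : Finset (Fin n → ℕ), IsAntichain (· ≤ ·) (↑M : Set (Fin n → ℕ)) ∧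
      M ⊆ A.image (fun a => Function.update a j₀ (∑ j ∈ J, a j) - i • Pi.single j₀ 1) ∧
      (∀ a ∈ A, ∃ m ∈ M, m ≤ Function.update a j₀ (∑ j ∈ J, a j) - i • Pi.single j₀ 1) ∧
      g ∈ Ideal.span (uPow u' '' ↑M) ∧
      ∀ B : Set (Fin n → ℕ), g ∈ Ideal.span (uPow u' '' B) → ∀ m ∈ M, ∃ b ∈ B, b ≤ m := by
  classical
  obtain ⟨M₀, γ', hanti, hsub, hrefine, hγ', hf'⟩ :=
    exists_expansion_map_of_expansion ψ u u' _ (update_sum_injective hj₀)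
      (map_uPow_eq_uPow_update ψ u u' hj₀ hrel) hψ hγ hf
  -- all `m ∈ M₀` have `m_{j₀} ≥ i`
  have hM₀ : ∀ m ∈ M₀, i ≤ m j₀ := by
    intro m hm
    obtain ⟨a, ha, rfl⟩ := Finset.mem_image.mp (hsub hm)
    rw [Function.update_self]
    exact hAi a ha
  set e : Fin n → ℕ := i • Pi.single j₀ 1 with he
  -- the expansion of `g`
  have hgexp : g = ∑ m ∈ M₀, γ' m * uPow u' (m - e) :=
    expansion_of_mul_pow_eq u' j₀ i hnzd hM₀ (hg.trans hf')
  -- reindex over `M := M₀ - e`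
  have hinj : Set.InjOn (fun m => m - e) ↑M₀ := by
    intro m₁ hm₁ m₂ hm₂ h
    funext l
    have := congrFun h l
    have h2 := hM₀ m₁ hm₁
    have h3 := hM₀ m₂ hm₂
    simp only [he, Pi.sub_apply, Pi.smul_apply, smul_eq_mul] at this
    by_cases hl : l = j₀
    · subst hl
      simp only [Pi.single_eq_same, mul_one] at this
      exact (tsub_left_inj h2 h3).mp this
    · simp only [Pi.single_apply, if_neg hl, mul_zero, Nat.sub_zero] at this
      exact this
  have hgexp' : g = ∑ m ∈ M₀.image (fun m => m - e), (fun m => γ' (m + e)) m * uPow u' m := by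
    rw [hgexp, Finset.sum_image hinj]
    refine Finset.sum_congr rfl fun m hm => ?_
    congr 2
    funext l
    have h2 := hM₀ m hm
    simp only [he, Pi.add_apply, Pi.sub_apply, Pi.smul_apply, smul_eq_mul]
    by_cases hl : l = j₀
    · subst hl
      simp only [Pi.single_eq_same, mul_one]
      exact (Nat.sub_add_cancel h2).symm
    · simp only [Pi.single_apply, if_neg hl, mul_zero, Nat.sub_zero, Nat.add_zero]
  have hanti' := isAntichain_image_sub_of_le hanti hM₀
  have hγ'' : ∀ m ∈ M₀.image (fun m => m - e), γ' (m + e) ∉ Ideal.span (Set.range u') := by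
    intro m hm
    obtain ⟨m₀, hm₀, rfl⟩ := Finset.mem_image.mp hm
    have : m₀ - e + e = m₀ := by
      funext l
      have h2 := hM₀ m₀ hm₀
      simp only [he, Pi.add_apply, Pi.sub_apply, Pi.smul_apply, smul_eq_mul]
      by_cases hl : l = j₀
      · subst hl
        simp only [Pi.single_eq_same, mul_one]
        exact Nat.sub_add_cancel h2
      · simp only [Pi.single_apply, if_neg hl, mul_zero, Nat.sub_zero, Nat.add_zero]
    rw [this]
    exact hγ' m₀ hm₀
  refine ⟨M₀.image (fun m => m - e), hanti', ?_, ?_, ?_,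
    minimal_of_coeff_not_mem u' H' hanti' hγ'' hgexp'⟩
  · intro m hm
    obtain ⟨m₀, hm₀, rfl⟩ := Finset.mem_image.mp hm
    obtain ⟨a, ha, rfl⟩ := Finset.mem_image.mp (hsub hm₀)
    exact Finset.mem_image.mpr ⟨a, ha, rfl⟩
  · intro a ha
    obtain ⟨m, hm, hle⟩ := hrefine _ (Finset.mem_image_of_mem _ ha)
    exact ⟨m - e, Finset.mem_image_of_mem _ hm, fun l => Nat.sub_le_sub_right (hle l) _⟩
  · rw [hgexp']
    exact Submodule.sum_mem _ fun m hm => Ideal.mul_mem_left _ _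
      (uPow_mem_span_uPow u' (Finset.mem_coe.mpr hm))

/-! ## The affine map `l` on `ℝⁿ` and its bookkeeping -/

/-- **`⟨α', l(y)⟩ = ⟨β, y⟩ - α'_{j₀}`** for `l(y) = (…, Σ_{j ∈ J} y_j - 1, …)` (the `j₀`-th
coordinate) and `β_j = α'_j + α'_{j₀}` (`j ∈ J ∖ {j₀}`), `β_j = α'_j` otherwise.
[cite: CossartPiltant2019, Prop. 2.6, (2.8) (arXiv v1 p. 13)] -/
theorem sum_mul_update_sum_sub_one {J : Finset (Fin n)} {j₀ : Fin n} (hj₀ : j₀ ∈ J)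
    (α' : Fin n → ℝ) (y : Fin n → ℝ) :
    ∑ j, α' j * Function.update y j₀ (∑ j ∈ J, y j - 1) j =
      ∑ j, (if j ∈ J ∧ j ≠ j₀ then α' j + α' j₀ else α' j) * y j - α' j₀ := by
  classical
  rw [← Finset.add_sum_erase Finset.univ _ (Finset.mem_univ j₀),
    ← Finset.add_sum_erase Finset.univ (fun j => (if j ∈ J ∧ j ≠ j₀ then α' j + α' j₀ else α' j) * y j)
      (Finset.mem_univ j₀)]
  simp only [Function.update_self, ne_eq, not_true_eq_false, and_false, if_false]
  have h1 : ∑ j ∈ Finset.univ.erase j₀, α' j * Function.update y j₀ (∑ j ∈ J, y j - 1) j =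
      ∑ j ∈ Finset.univ.erase j₀, α' j * y j := by
    refine Finset.sum_congr rfl fun j hj => ?_
    rw [Function.update_of_ne (Finset.ne_of_mem_erase hj)]
  have h2 : ∑ j ∈ Finset.univ.erase j₀, (if j ∈ J ∧ j ≠ j₀ then α' j + α' j₀ else α' j) * y j =
      ∑ j ∈ Finset.univ.erase j₀, α' j * y j + α' j₀ * ∑ j ∈ J.erase j₀, y j := by
    have : ∀ j ∈ Finset.univ.erase j₀, (if j ∈ J ∧ j ≠ j₀ then α' j + α' j₀ else α' j) * y j =
        α' j * y j + (if j ∈ J ∧ j ≠ j₀ then α' j₀ * y j else 0) := by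
      intro j _
      split_ifs with h
      · ring
      · ring
    rw [Finset.sum_congr rfl this, Finset.sum_add_distrib, ← Finset.sum_filter, Finset.mul_sum]
    congr 1
    refine Finset.sum_congr ?_ fun _ _ => rfl
    ext j
    simp [Finset.mem_erase, and_comm]
  rw [h1, h2, ← Finset.add_sum_erase J y hj₀]
  ring

/-- `l` is injective on `ℝⁿ`. [folklore] -/
theorem update_sum_sub_one_injective {J : Finset (Fin n)} {j₀ : Fin n} (hj₀ : j₀ ∈ J) :
    Function.Injective (fun y : Fin n → ℝ => Function.update y j₀ (∑ j ∈ J, y j - 1)) := by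
  classical
  intro a b hab
  have hne : ∀ j, j ≠ j₀ → a j = b j := by
    intro j hj
    have h1 : Function.update a j₀ (∑ j ∈ J, a j - 1) j = Function.update b j₀ (∑ j ∈ J, b j - 1) j :=
      congrFun hab j
    rwa [Function.update_of_ne hj, Function.update_of_ne hj] at h1
  have hsum : ∑ j ∈ J, a j - 1 = ∑ j ∈ J, b j - 1 := by
    have h1 : Function.update a j₀ (∑ j ∈ J, a j - 1) j₀ =
        Function.update b j₀ (∑ j ∈ J, b j - 1) j₀ := congrFun hab j₀
    rwa [Function.update_self, Function.update_self] at h1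
  funext j
  by_cases hj : j = j₀
  · subst hj
    rw [← Finset.add_sum_erase _ _ hj₀, ← Finset.add_sum_erase _ _ hj₀] at hsum
    have : ∑ x ∈ J.erase j, a x = ∑ x ∈ J.erase j, b x :=
      Finset.sum_congr rfl fun x hx => hne x (Finset.ne_of_mem_erase hx)
    linarith
  · exact hne j hj

/-- **Generating points transform by `l`**: `(l₀(a) - i e_{j₀}) / i = l(a / i)` when
`Σ_{j ∈ J} a_j ≥ i`. [cite: CossartPiltant2019, Prop. 2.6, proof (arXiv v1 p. 13)] -/
theorem cast_update_sub_div_eq {J : Finset (Fin n)} {j₀ : Fin n} {i : ℕ} (hi : 0 < i)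
    {a : Fin n → ℕ} (ha : i ≤ ∑ j ∈ J, a j) :
    (fun j => (((Function.update a j₀ (∑ j ∈ J, a j) - i • (Pi.single j₀ 1 : Fin n → ℕ)) j : ℕ) : ℝ) / i) =
      Function.update (fun j => (a j : ℝ) / i) j₀ (∑ j ∈ J, (a j : ℝ) / i - 1) := by
  classical
  have hipos : (0 : ℝ) < i := by exact_mod_cast hi
  funext j
  by_cases hj : j = j₀
  · subst hj
    simp only [Function.update_self, Pi.sub_apply, Pi.smul_apply, Pi.single_eq_same, smul_eq_mul,
      mul_one]
    rw [Nat.cast_sub ha, Nat.cast_sum, sub_div, div_self hipos.ne', Finset.sum_div]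
  · simp only [Function.update_of_ne hj, Pi.sub_apply, Pi.smul_apply, Pi.single_apply, if_neg hj,
      smul_eq_mul, mul_zero, Nat.sub_zero]

/-- Strict monotonicity of `|·|_{α'}` for `α' > 0`. [folklore] -/
theorem weight_lt_of_le_of_ne {α : Fin n → ℝ} (hα : ∀ j, 0 < α j) {a b : Fin n → ℕ} (hle : a ≤ b)
    (hne : a ≠ b) : weight α a < weight α b := by
  obtain ⟨l, hl⟩ : ∃ l, a l ≠ b l := by
    by_contra hcon
    push Not at hcon
    exact hne (funext hcon)
  have hlt : a l < b l := lt_of_le_of_ne (hle l) hl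
  unfold weight
  refine Finset.sum_lt_sum (fun j _ => mul_le_mul_of_nonneg_left (by exact_mod_cast hle j) (hα j).le)
    ⟨l, Finset.mem_univ l, mul_lt_mul_of_pos_left (by exact_mod_cast hlt) (hα l)⟩

/-- `l₀(i x) - i e_{j₀} = i · l_ℕ(x)` with `l_ℕ(x) = (…, Σ_{j ∈ J} x_j - 1, …)` for `x ∈ ℕⁿ`
(truncated subtraction on both sides). [folklore] -/
theorem update_nsmul_sub_eq {J : Finset (Fin n)} {j₀ : Fin n} (i : ℕ) (x : Fin n → ℕ) :
    Function.update (i • x) j₀ (∑ j ∈ J, (i • x) j) - i • (Pi.single j₀ 1 : Fin n → ℕ) =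
      i • Function.update x j₀ (∑ j ∈ J, x j - 1) := by
  classical
  funext j
  by_cases hj : j = j₀
  · subst hj
    simp only [Pi.sub_apply, Function.update_self, Pi.smul_apply, smul_eq_mul, Pi.single_eq_same,
      mul_one, ← Finset.mul_sum]
    rw [Nat.mul_sub, mul_one]
  · simp only [Pi.sub_apply, Function.update_of_ne hj, Pi.smul_apply, smul_eq_mul, Pi.single_apply,
      if_neg hj, mul_zero, Nat.sub_zero]

/-- `weight α b / i = Σ_j α_j (b_j / i)`. [folklore] -/
theorem weight_div_eq_sum (α : Fin n → ℝ) (b : Fin n → ℕ) (i : ℕ) :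
    weight α b / i = ∑ j, α j * ((b j : ℝ) / i) := by
  unfold weight
  rw [Finset.sum_div]
  refine Finset.sum_congr rfl fun j _ => ?_
  ring

/-- The quotient map `S/(u) → S'/(u')` induced by `ψ` is well defined: `ψ((u)) ⊆ (u')`.
[folklore] -/
theorem span_range_le_comap (ψ : S →+* S') (u : Fin n → S) (u' : Fin n → S')
    {J : Finset (Fin n)} {j₀ : Fin n}
    (hrel : ∀ j, ψ (u j) = if j ∈ J ∧ j ≠ j₀ then u' j₀ * u' j else u' j) :
    Ideal.span (Set.range u) ≤ (Ideal.span (Set.range u')).comap ψ := by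
  rw [Ideal.span_le]
  rintro _ ⟨j, rfl⟩
  rw [SetLike.mem_coe, Ideal.mem_comap, hrel j]
  split_ifs
  · exact Ideal.mul_mem_left _ _ (Ideal.subset_span (Set.mem_range_self j))
  · exact Ideal.subset_span (Set.mem_range_self j)

/-! ## `𝐒(f_{i,Z'})` versus `𝐒(f_{i,Z})` for the coefficients of `h'` -/

section OriginChart

variable [IsNoetherianRing S] [IsLocalRing S]
  (ψ : S →+* S') (u : Fin n → S) (u' : Fin n → S')
  (H : ∀ (i : Fin n) (T : Finset (Fin n)), i ∉ T →
    ∀ y, u i * y ∈ Ideal.span (u '' ↑T) → y ∈ Ideal.span (u '' ↑T))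
  (hu : ∀ i, u i ∈ maximalIdeal S)
  (H' : ∀ (i : Fin n) (T : Finset (Fin n)), i ∉ T →
    ∀ y, u' i * y ∈ Ideal.span (u' '' ↑T) → y ∈ Ideal.span (u' '' ↑T))
  {J : Finset (Fin n)} {j₀ : Fin n} (hj₀ : j₀ ∈ J) (hnzd : ∀ y : S', u' j₀ * y = 0 → y = 0)
  (hrel : ∀ j, ψ (u j) = if j ∈ J ∧ j ≠ j₀ then u' j₀ * u' j else u' j)
  (hψ : ∀ γ : S, ψ γ ∈ Ideal.span (Set.range u') → γ ∈ Ideal.span (Set.range u))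

include H hu H' hj₀ hnzd hrel hψ

/-- **Prop. 2.6 for one coefficient**: if `g · u'_{j₀}^i = ψ(f)` and every `a ∈ 𝐒(f)` has
`Σ_{j ∈ J} a_j ≥ i`, then (1) every `a' ∈ 𝐒(g)` is `l₀(a) - i e_{j₀}` for some `a ∈ 𝐒(f)`, and
(2) every `l₀(a) - i e_{j₀}`, `a ∈ 𝐒(f)`, lies above some `a' ∈ 𝐒(g)`.
[cite: CossartPiltant2019, Prop. 2.6, proof (arXiv v1 p. 13)] -/
theorem minExponents_of_mul_pow_eq {f : S} {i : ℕ}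
    (hfi : ∀ a ∈ minExponents u f, i ≤ ∑ j ∈ J, a j) {g : S'} (hg : g * u' j₀ ^ i = ψ f) :
    (∀ a' ∈ minExponents u' g, ∃ a ∈ minExponents u f,
        a' = Function.update a j₀ (∑ j ∈ J, a j) - i • Pi.single j₀ 1) ∧
      (∀ a ∈ minExponents u f, ∃ a' ∈ minExponents u' g,
        a' ≤ Function.update a j₀ (∑ j ∈ J, a j) - i • Pi.single j₀ 1) := by
  classical
  obtain ⟨hA1, hA2, hA3⟩ := minExponents_spec' u H hu f
  obtain ⟨γ, hγ⟩ := exists_expansion_minExponents u hA2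
  have hγu : ∀ a ∈ minExponents u f, γ a ∉ Ideal.span (Set.range u) :=
    coeff_not_mem_of_minimal u hA1 hA3 hγ
  obtain ⟨M, hManti, hMsub, hMref, hgM, hMmin⟩ :=
    exists_minimal_of_mul_pow_eq ψ u u' H' hj₀ hnzd hrel hψ hγu hγ hfi hg
  have hMeq : minExponents u' g = M := minExponents_eq u' hManti hgM hMmin
  rw [hMeq]
  refine ⟨fun a' ha' => ?_, fun a ha => hMref a ha⟩
  obtain ⟨a, ha, rfl⟩ := Finset.mem_image.mp (hMsub ha')
  exact ⟨a, ha, rfl⟩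

/-- The coefficient classes at the origin chart: with the expansion data of
`exists_expansion_map_of_expansion'`, **`γ̄'(g, l₀(a) - i e_{j₀}) = ψ̄(γ̄(f, a))`** whenever
`l₀(a) - i e_{j₀} ∈ 𝐒(g)`, and `l₀(a) - i e_{j₀} ∈ 𝐒(g)` forces `a ∈ 𝐒(f)`.
[cite: CossartPiltant2019, Prop. 2.6, proof (arXiv v1 p. 14)] -/
theorem coeffClass_of_mul_pow_eq {f : S} {i : ℕ}
    (hfi : ∀ a ∈ minExponents u f, i ≤ ∑ j ∈ J, a j) {g : S'} (hg : g * u' j₀ ^ i = ψ f)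
    (a : Fin n → ℕ) (hai : i ≤ ∑ j ∈ J, a j)
    (ha' : Function.update a j₀ (∑ j ∈ J, a j) - i • Pi.single j₀ 1 ∈ minExponents u' g) :
    a ∈ minExponents u f ∧
      coeffClass u' g (Function.update a j₀ (∑ j ∈ J, a j) - i • Pi.single j₀ 1) =
        Ideal.quotientMap (Ideal.span (Set.range u')) ψ (span_range_le_comap ψ u u' hrel)
          (coeffClass u f a) := by
  classical
  obtain ⟨hA1, hA2, hA3⟩ := minExponents_spec' u H hu f
  obtain ⟨γ, hγ⟩ := exists_expansion_minExponents u hA2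
  have hγu : ∀ a ∈ minExponents u f, γ a ∉ Ideal.span (Set.range u) :=
    coeff_not_mem_of_minimal u hA1 hA3 hγ
  -- the transported expansion of `ψ f` and of `g`
  obtain ⟨M, γ', hManti, hMsub, hMref, hγ'u, hfM, hcong⟩ :=
    exists_expansion_map_of_expansion' ψ u u' _ (update_sum_injective hj₀)
      (map_uPow_eq_uPow_update ψ u u' hj₀ hrel) hψ hγu hγ
  have hM₀ : ∀ m ∈ M, i ≤ m j₀ := by
    intro m hm
    obtain ⟨b, hb, rfl⟩ := Finset.mem_image.mp (hMsub hm)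
    rw [Function.update_self]
    exact hfi b hb
  set e : Fin n → ℕ := i • Pi.single j₀ 1 with he
  have hgexp : g = ∑ m ∈ M, γ' m * uPow u' (m - e) :=
    expansion_of_mul_pow_eq u' j₀ i hnzd hM₀ (hg.trans hfM)
  -- reindexed over `M - e`
  have hcancel : ∀ m ∈ M, m - e + e = m := by
    intro m hm
    funext l
    have h2 := hM₀ m hm
    simp only [he, Pi.add_apply, Pi.sub_apply, Pi.smul_apply, smul_eq_mul]
    by_cases hl : l = j₀
    · subst hl
      simp only [Pi.single_eq_same, mul_one]
      exact Nat.sub_add_cancel h2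
    · simp only [Pi.single_apply, if_neg hl, mul_zero, Nat.sub_zero, Nat.add_zero]
  have hinj : Set.InjOn (fun m => m - e) ↑M := by
    intro m₁ hm₁ m₂ hm₂ h
    have : m₁ - e + e = m₂ - e + e := by
      have h' : m₁ - e = m₂ - e := h
      rw [h']
    rwa [hcancel m₁ hm₁, hcancel m₂ hm₂] at this
  have hgexp' : g = ∑ m ∈ M.image (fun m => m - e), (fun m => γ' (m + e)) m * uPow u' m := by
    rw [hgexp, Finset.sum_image hinj]
    refine Finset.sum_congr rfl fun m hm => ?_
    simp only [hcancel m hm]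
  have hanti' := isAntichain_image_sub_of_le hManti hM₀
  have hγ'' : ∀ m ∈ M.image (fun m => m - e), γ' (m + e) ∉ Ideal.span (Set.range u') := by
    intro m hm
    obtain ⟨m₀, hm₀, rfl⟩ := Finset.mem_image.mp hm
    rw [hcancel m₀ hm₀]
    exact hγ'u m₀ hm₀
  have hgM' : g ∈ Ideal.span (uPow u' '' ↑(M.image (fun m => m - e))) := by
    rw [hgexp']
    exact Submodule.sum_mem _ fun m hm => Ideal.mul_mem_left _ _
      (uPow_mem_span_uPow u' (Finset.mem_coe.mpr hm))
  have hMeq : minExponents u' g = M.image (fun m => m - e) :=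
    minExponents_eq u' hanti' hgM' (minimal_of_coeff_not_mem u' H' hanti' hγ'' hgexp')
  -- `l₀(a) - e ∈ 𝐒(g) = M - e` gives `l₀(a) ∈ M ⊆ l₀(𝐒(f))`, so `a ∈ 𝐒(f)`
  rw [hMeq] at ha'
  obtain ⟨m₀, hm₀, hm₀eq⟩ := Finset.mem_image.mp ha'
  have hla : Function.update a j₀ (∑ j ∈ J, a j) - e + e = Function.update a j₀ (∑ j ∈ J, a j) := by
    funext l
    simp only [he, Pi.add_apply, Pi.sub_apply, Pi.smul_apply, smul_eq_mul]
    by_cases hl : l = j₀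
    · subst hl
      simp only [Function.update_self, Pi.single_eq_same, mul_one]
      exact Nat.sub_add_cancel hai
    · simp only [Pi.single_apply, if_neg hl, mul_zero, Nat.sub_zero, Nat.add_zero]
  have hm₀la : m₀ = Function.update a j₀ (∑ j ∈ J, a j) := by
    have : m₀ - e + e = Function.update a j₀ (∑ j ∈ J, a j) - e + e := by rw [hm₀eq]
    rwa [hcancel m₀ hm₀, hla] at this
  obtain ⟨b, hb, hbeq⟩ := Finset.mem_image.mp (hMsub hm₀)
  have hba : b = a := update_sum_injective hj₀ (hbeq.trans hm₀la)
  subst hba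
  refine ⟨hb, ?_⟩
  -- the classes
  have hmemM : Function.update b j₀ (∑ j ∈ J, b j) ∈ M := hm₀la ▸ hm₀
  rw [coeffClass_eq_mk u' H' (hMeq ▸ hanti') (hMeq ▸ hgexp') (hMeq ▸ ha'),
    coeffClass_eq_mk u H hA1 hγ hb, Ideal.quotientMap_mk, hla]
  exact (Ideal.Quotient.eq.mpr (hcong b hb hmemM))

variable {h : Polynomial S} {h' : Polynomial S'} (hdeg : h'.natDegree = h.natDegree)
  (hcoef : ∀ i ∈ Finset.Icc 1 h.natDegree,
    h'.coeff (h.natDegree - i) * u' j₀ ^ i = ψ (h.coeff (h.natDegree - i)))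
  (hIJ : ∀ i ∈ Finset.Icc 1 h.natDegree, ∀ a ∈ minExponents u (h.coeff (h.natDegree - i)),
    i ≤ ∑ j ∈ J, a j)

include hdeg hcoef hIJ

/-- **Prop. 2.6: vertices of `Δ_{S'}(h'; u'; Z')` come from vertices of `Δ_S(h; u; Z)`.**  If
`l(x)` is the vertex of `Δ'` cut out by `α' > 0`, then `x` is the vertex of `Δ` cut out by
`β = (α'_j + α'_{j₀} [j ∈ J ∖ j₀], α'_j [otherwise])` — since the generating points of `Δ'` are the
`l(a/i)` for the minimal `l₀(a)`, `a ∈ 𝐒(f_{i,Z})`, and `⟨α', l(y)⟩ = ⟨β, y⟩ - α'_{j₀}`.  Here `h'`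
is the polynomial with `f_{i,Z'} u'_{j₀}^i = ψ(f_{i,Z})` (`h' = u_{j₀}^{-m} h(u_{j₀} Z')`), which
requires `f_{i,Z} ∈ I_J^i` (`δ(y) ≥ 1`). [cite: CossartPiltant2019, Prop. 2.6 (arXiv v1 pp. 13–14)] -/
theorem isVertexFor_of_isVertexFor_map {α' : Fin n → ℝ} (hα' : ∀ j, 0 < α' j) {x : Fin n → ℝ}
    (hx' : IsVertexFor u' h' α' (Function.update x j₀ (∑ j ∈ J, x j - 1))) :
    IsVertexFor u h (fun j => if j ∈ J ∧ j ≠ j₀ then α' j + α' j₀ else α' j) x := by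
  classical
  set β : Fin n → ℝ := fun j => if j ∈ J ∧ j ≠ j₀ then α' j + α' j₀ else α' j with hβ
  have hα'0 : ∀ j, 0 ≤ α' j := fun j => (hα' j).le
  unfold IsVertexFor at hx'
  rw [hdeg] at hx'
  obtain ⟨hx'1, hx'2⟩ := hx'
  have hW := sum_mul_update_sum_sub_one hj₀ α' x
  -- the generating point `a/i` of `Δ` versus `l(a/i) = (l₀ a - ie)/i` of `Δ'`
  have hGP : ∀ (i : ℕ), 0 < i → ∀ (a : Fin n → ℕ), i ≤ ∑ j ∈ J, a j →
      weight α' (Function.update a j₀ (∑ j ∈ J, a j) - i • Pi.single j₀ 1) / i =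
        weight β a / i - α' j₀ := by
    intro i hi a ha
    rw [weight_div_eq_sum, weight_div_eq_sum]
    have := sum_mul_update_sum_sub_one hj₀ α' (fun j => (a j : ℝ) / i)
    rw [← cast_update_sub_div_eq hi ha] at this
    rw [this]
  refine ⟨fun i hi a ha => ?_, ?_⟩
  · have hipos : 0 < i := (Finset.mem_Icc.mp hi).1
    have hiposR : (0 : ℝ) < i := by exact_mod_cast hipos
    obtain ⟨a', ha', hle'⟩ :=
      (minExponents_of_mul_pow_eq ψ u u' H hu H' hj₀ hnzd hrel hψ (hIJ i hi) (hcoef i hi)).2 a ha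
    obtain ⟨hineq, huniq⟩ := hx'1 i hi a' ha'
    rw [hW] at hineq huniq
    have hmono : weight α' a' ≤
        weight α' (Function.update a j₀ (∑ j ∈ J, a j) - i • Pi.single j₀ 1) :=
      weight_mono hα'0 hle'
    have hmono' := div_le_div_of_nonneg_right hmono hiposR.le
    rw [hGP i hipos a (hIJ i hi a ha)] at hmono'
    refine ⟨by linarith, fun heq => ?_⟩
    -- equality: `a' = l₀ a - ie` and `l(x) = a'/i = l(a/i)`
    have heq1 : weight α' a' / i = ∑ j, β j * x j - α' j₀ := by
      apply le_antisymm (by linarith)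
      exact hineq
    have heq2 : weight α' a' = weight α' (Function.update a j₀ (∑ j ∈ J, a j) - i • Pi.single j₀ 1) := by
      apply le_antisymm hmono
      have : weight α' (Function.update a j₀ (∑ j ∈ J, a j) - i • Pi.single j₀ 1) / i ≤
          weight α' a' / i := by rw [hGP i hipos a (hIJ i hi a ha), heq1, heq]
      exact (div_le_div_iff_of_pos_right hiposR).mp this
    have ha'eq : a' = Function.update a j₀ (∑ j ∈ J, a j) - i • Pi.single j₀ 1 := by
      by_contra hne
      exact (weight_lt_of_le_of_ne hα' hle' hne).ne heq2
    have hlx := huniq heq1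
    -- `l(x) = a'/i = l(a/i)`
    rw [ha'eq, cast_update_sub_div_eq hipos (hIJ i hi a ha)] at hlx
    exact update_sum_sub_one_injective hj₀ hlx
  · obtain ⟨i, hi, a', ha', ha'x⟩ := hx'2
    have hipos : 0 < i := (Finset.mem_Icc.mp hi).1
    obtain ⟨a, ha, rfl⟩ :=
      (minExponents_of_mul_pow_eq ψ u u' H hu H' hj₀ hnzd hrel hψ (hIJ i hi) (hcoef i hi)).1 a' ha'
    refine ⟨i, hi, a, ha, ?_⟩
    rw [cast_update_sub_div_eq hipos (hIJ i hi a ha)] at ha'x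
    exact update_sum_sub_one_injective hj₀ ha'x

/-- **Prop. 2.6: a solvable vertex of `Δ_{S'}(h'; u'; Z')` comes from a solvable vertex of
`Δ_S(h; u; Z)`** ("Since `S'/m_{S'} = S/m_S`, definition 2.3 then shows that `x'` is solvable if
and only if `x` is solvable"), when `S/(u) → S'/(u')` is onto (here: an isomorphism, by (hψ)).
[cite: CossartPiltant2019, Prop. 2.6, proof (arXiv v1 p. 14)] -/
theorem exists_isSolvableVertex_of_isSolvableVertex_map
    (hsurj : ∀ s' : S', ∃ s : S, ψ s - s' ∈ Ideal.span (Set.range u'))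
    {x' : Fin n → ℕ} (hx' : IsSolvableVertex u' h' x') :
    ∃ x : Fin n → ℕ, Function.update x j₀ (∑ j ∈ J, x j - 1) = x' ∧ 1 ≤ ∑ j ∈ J, x j ∧
      IsSolvableVertex u h x := by
  classical
  obtain ⟨⟨α', hα', hvert'⟩, lam', hsolv'⟩ := hx'
  have hvertc := hvert'
  -- the real preimage of `x'` under `l`
  set xR : Fin n → ℝ := Function.update (fun j => (x' j : ℝ)) j₀
    ((x' j₀ : ℝ) + 1 - ∑ j ∈ J.erase j₀, (x' j : ℝ)) with hxR
  have hlxR : Function.update xR j₀ (∑ j ∈ J, xR j - 1) = fun j => (x' j : ℝ) := by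
    funext j
    by_cases hj : j = j₀
    · subst hj
      rw [Function.update_self, ← Finset.add_sum_erase _ _ hj₀]
      have : ∑ x ∈ J.erase j, xR x = ∑ x ∈ J.erase j, (x' x : ℝ) :=
        Finset.sum_congr rfl fun l hl => by rw [hxR, Function.update_of_ne (Finset.ne_of_mem_erase hl)]
      rw [this, hxR, Function.update_self]
      ring
    · rw [Function.update_of_ne hj, hxR, Function.update_of_ne hj]
  rw [← hlxR] at hvert'
  have hvert := isVertexFor_of_isVertexFor_map ψ u u' H hu H' hj₀ hnzd hrel hψ hdeg hcoef hIJ hα' hvert'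
  -- `xR = a/i ≥ 0`, so `xR_{j₀} ≥ 0` and `xR ∈ ℕⁿ`
  obtain ⟨i₀, hi₀, a₀, ha₀, ha₀x⟩ := hvert.2
  have hnonneg : (0 : ℝ) ≤ xR j₀ := by
    have := congrFun ha₀x j₀
    rw [← this]
    exact div_nonneg (Nat.cast_nonneg _) (Nat.cast_nonneg _)
  have hle : ∑ j ∈ J.erase j₀, x' j ≤ x' j₀ + 1 := by
    have h1 : xR j₀ = (x' j₀ : ℝ) + 1 - ∑ j ∈ J.erase j₀, (x' j : ℝ) := by rw [hxR, Function.update_self]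
    rw [h1] at hnonneg
    have : (∑ j ∈ J.erase j₀, x' j : ℕ) ≤ ((x' j₀ + 1 : ℕ) : ℝ) := by push_cast; linarith
    exact_mod_cast this
  set x : Fin n → ℕ := Function.update x' j₀ (x' j₀ + 1 - ∑ j ∈ J.erase j₀, x' j) with hx
  have hxcast : (fun j => (x j : ℝ)) = xR := by
    funext j
    by_cases hj : j = j₀
    · subst hj
      rw [hx, hxR, Function.update_self, Function.update_self, Nat.cast_sub hle]
      push_cast
      ring
    · rw [hx, hxR, Function.update_of_ne hj, Function.update_of_ne hj]
  have hsumx : ∑ j ∈ J, x j = x' j₀ + 1 := by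
    rw [← Finset.add_sum_erase _ _ hj₀, hx, Function.update_self]
    have : ∑ l ∈ J.erase j₀, Function.update x' j₀ (x' j₀ + 1 - ∑ j ∈ J.erase j₀, x' j) l =
        ∑ l ∈ J.erase j₀, x' l :=
      Finset.sum_congr rfl fun l hl => by rw [Function.update_of_ne (Finset.ne_of_mem_erase hl)]
    rw [this]
    omega
  have hlx : Function.update x j₀ (∑ j ∈ J, x j - 1) = x' := by
    funext j
    by_cases hj : j = j₀
    · subst hj
      rw [Function.update_self, hsumx]
      omega
    · rw [Function.update_of_ne hj, hx, Function.update_of_ne hj]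
  refine ⟨x, hlx, by omega, ⟨fun j => if j ∈ J ∧ j ≠ j₀ then α' j + α' j₀ else α' j,
    fun j => ?_, ?_⟩, ?_⟩
  · show 0 < (if j ∈ J ∧ j ≠ j₀ then α' j + α' j₀ else α' j)
    split_ifs
    · exact add_pos (hα' j) (hα' j₀)
    · exact hα' j
  · rw [hxcast]
    exact hvert
  · -- the coefficient classes: through the injective map `θ : S/(u) → S'/(u')`
    obtain ⟨lam, hlam⟩ := hsurj lam'
    set θ := Ideal.quotientMap (Ideal.span (Set.range u')) ψ (span_range_le_comap ψ u u' hrel) with hθ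
    have hθinj : Function.Injective θ := by
      refine (injective_iff_map_eq_zero θ).mpr fun q hq => ?_
      obtain ⟨sq, rfl⟩ := Ideal.Quotient.mk_surjective q
      rw [hθ, Ideal.quotientMap_mk, Ideal.Quotient.eq_zero_iff_mem] at hq
      exact Ideal.Quotient.eq_zero_iff_mem.mpr (hψ _ hq)
    refine ⟨lam, fun i hi => hθinj ?_⟩
    have hi' : i ∈ Finset.Icc 1 h'.natDegree := hdeg ▸ hi
    have hipos : 0 < i := (Finset.mem_Icc.mp hi).1
    -- right-hand side: `θ(C(m,i)(-λ)^i) = C(m,i)(-λ')^i = γ̄'(f_{i,Z'}, i x')`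
    have hrhs : θ (Ideal.Quotient.mk _ ((h.natDegree.choose i : S) * (-lam) ^ i)) =
        coeffClass u' (h'.coeff (h.natDegree - i)) (i • x') := by
      have h1 := hsolv' i hi'
      rw [hdeg] at h1
      rw [h1, hθ, Ideal.quotientMap_mk, map_mul, map_pow, map_neg, map_natCast, Ideal.Quotient.eq]
      have hll : Ideal.Quotient.mk (Ideal.span (Set.range u')) (ψ lam) =
          Ideal.Quotient.mk (Ideal.span (Set.range u')) lam' := Ideal.Quotient.eq.mpr hlam
      have : Ideal.Quotient.mk (Ideal.span (Set.range u')) ((h.natDegree.choose i : S') * (-ψ lam) ^ i) =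
          Ideal.Quotient.mk (Ideal.span (Set.range u')) ((h.natDegree.choose i : S') * (-lam') ^ i) := by
        simp only [map_mul, map_pow, map_neg, map_natCast, hll]
      exact Ideal.Quotient.eq.mp this
    rw [hrhs]
    -- left-hand side
    have hupd : Function.update (i • x) j₀ (∑ j ∈ J, (i • x) j) - i • (Pi.single j₀ 1 : Fin n → ℕ) =
        i • x' := by
      rw [update_nsmul_sub_eq i x, hlx]
    have hai : i ≤ ∑ j ∈ J, (i • x) j := by
      simp only [Pi.smul_apply, smul_eq_mul, ← Finset.mul_sum, hsumx]
      nlinarith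
    by_cases hmem : i • x' ∈ minExponents u' (h'.coeff (h.natDegree - i))
    · have key := (coeffClass_of_mul_pow_eq ψ u u' H hu H' hj₀ hnzd hrel hψ (hIJ i hi) (hcoef i hi)
        (i • x) hai (by rw [hupd]; exact hmem)).2
      rw [hupd] at key
      exact key.symm
    · -- `i x' ∉ 𝐒(f_{i,Z'})` forces `i x ∉ 𝐒(f_{i,Z})` (vertex property of `x'`)
      have hnot : i • x ∉ minExponents u (h.coeff (h.natDegree - i)) := by
        intro hin
        obtain ⟨a', ha', hle'⟩ :=
          (minExponents_of_mul_pow_eq ψ u u' H hu H' hj₀ hnzd hrel hψ (hIJ i hi) (hcoef i hi)).2 _ hin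
        rw [hupd] at hle'
        apply hmem
        -- `a' = i x'`
        unfold IsVertexFor at hvertc
        rw [hdeg] at hvertc
        obtain ⟨hineq, huniq⟩ := hvertc.1 i hi a' ha'
        have hiposR : (0 : ℝ) < i := by exact_mod_cast hipos
        have hw : weight α' a' / i ≤ ∑ j, α' j * (x' j : ℝ) := by
          have h1 : weight α' a' ≤ weight α' (i • x') := weight_mono (fun j => (hα' j).le) hle'
          rw [weight_nsmul] at h1
          rw [div_le_iff₀ hiposR]
          have : weight α' x' = ∑ j, α' j * (x' j : ℝ) := rfl
          rw [← this]
          linarith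
        have heq := huniq (le_antisymm hw hineq)
        have ha'eq : a' = i • x' := by
          funext j
          have hj := congrFun heq j
          have hj' : (a' j : ℝ) / i = (x' j : ℝ) := hj
          rw [div_eq_iff hiposR.ne'] at hj'
          have : (a' j : ℝ) = ((i * x' j : ℕ) : ℝ) := by rw [hj']; push_cast; ring
          simp only [Pi.smul_apply, smul_eq_mul]
          exact_mod_cast this
        rw [← ha'eq]
        exact ha'
      rw [coeffClass_eq_zero_of_not_mem u hnot, coeffClass_eq_zero_of_not_mem u' hmem, map_zero]

/-- **Prop. 2.6, second statement: minimality is preserved at the origin chart** — "Since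
`Δ_S(h; u; Z)` is minimal, the polyhedron `Δ_{S'}(h'; u'; Z')` is also minimal".
[cite: CossartPiltant2019, Prop. 2.6 (arXiv v1 pp. 13–14)] -/
theorem isMinimal_map_of_isMinimal
    (hsurj : ∀ s' : S', ∃ s : S, ψ s - s' ∈ Ideal.span (Set.range u'))
    (hmin : IsMinimal u h) : IsMinimal u' h' := by
  intro x' hx'
  obtain ⟨x, -, -, hx⟩ := exists_isSolvableVertex_of_isSolvableVertex_map ψ u u' H hu H' hj₀ hnzd
    hrel hψ hdeg hcoef hIJ hsurj hx'
  exact hmin x hx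

end OriginChart

end Literature.AlgebraicGeometry.Resolution.CossartPiltant
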